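import Mathlib.Analysis.SpecialFunctions.Pow.Real
import Mathlib.Analysis.SpecialFunctions.Sqrt
import Mathlib.Analysis.Calculus.Deriv.Inv
import Mathlib.Analysis.Calculus.Deriv.Add
import Mathlib.Analysis.Calculus.Deriv.Mul
import Mathlib.Analysis.Calculus.Deriv.Pow
import HarnessLib

/-!
# Ladder engine kit: the Chebyshev kernels in the half-angle coordinate (crux `HurwitzSectorComplement`,
# line `chebyshev-level-deformation`, stub S1 `stub_ladderEngine` — elementary real-analysis layer)

With `v = tan(u/2)` the Chebyshev generating kernels `Σ cos(nu) s^{n−1}`, `Σ sin(nu) s^{n−1}` are the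
RATIONAL functions
`T(v,s) = ((1−s) − v²(1+s))/den`, `U(v,s) = 2v/den`, `den(v,s) = (1−s)² + v²(1+s)²`,
and with `ω(v) = 2/(1+v²)` (`du = ω dv`) the closed 1-form `d(−½ log(1 − 2s cos u + s²))` gives the two
polynomial CERTIFICATES of the ladder, `∂_v T = −ω·∂_s(sU)`, `∂_v U = ω·∂_s(sT)`, where
`∂_s(sU) = 2v(1−s²)(1+v²)/den²`, `∂_s(sT) = (1+v²)((1−s)² − v²(1+s)²)/den²`.
This file records, with everything inlined (no definitions):
* positivity of `den`, the four derivative facts behind the two Newton–Leibniz moves of each step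
  (`hasDerivAt_kernelT_param`, `hasDerivAt_mul_kernelU`, `hasDerivAt_kernelU_param`, `hasDerivAt_mul_kernelT`);
* the pointwise bounds feeding the band integrability: `|T| ≤ 1/(1−s) + 1`, `0 ≤ U ≤ 1/(1−s)`,
  `U ≤ 2(1−s)^{−1/2}v^{−1/2}`, `|∂_vT| = 4v(1−s²)/den² ≤ 8(1−s)^{−3/2}v^{−1/2}`,
  `|∂_vU| ≤ 2/den ≤ 2(1−s)^{−3/2}v^{−1/2}` — all from the two Young-type polynomial inequalities
  `A⁵B³ ≤ (A⁴+B⁴)²`, `A³B ≤ A⁴+B⁴`.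
References: Kontsevich–Zagier, *Periods* (2001), §1.2 (rule 3, Newton–Leibniz with algebraic primitives).
-/

noncomputable section

namespace Summit.KontsevichZagierPeriods.Theorems.HurwitzMicroSectorsHurwitzSectorComplement.LadderEngine

/-! ## The denominator -/

/-- `den(v,s) = (1−s)² + v²(1+s)² > 0` as soon as `s ≠ 1`. [folklore] -/
theorem den_pos (v : ℝ) {s : ℝ} (hs : s ≠ 1) : 0 < (1 - s) ^ 2 + v ^ 2 * (1 + s) ^ 2 := by
  have h1 : 0 < (1 - s) ^ 2 := by
    have : (1 - s) ≠ 0 := sub_ne_zero.mpr (Ne.symm hs)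
    positivity
  have h2 : 0 ≤ v ^ 2 * (1 + s) ^ 2 := by positivity
  linarith

/-- On `0 ≤ s < 1`, `v ≥ 0`: `den(v,s) ≥ (1−s)² + v²`. [folklore] -/
theorem sq_add_sq_le_den {v s : ℝ} (hs0 : 0 ≤ s) :
    (1 - s) ^ 2 + v ^ 2 ≤ (1 - s) ^ 2 + v ^ 2 * (1 + s) ^ 2 := by
  have h : v ^ 2 * 1 ≤ v ^ 2 * (1 + s) ^ 2 := by
    apply mul_le_mul_of_nonneg_left _ (sq_nonneg v)
    nlinarith
  linarith

/-! ## Values of the kernels at `v = 0` -/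

/-- `T(0,s) = 1/(1−s)`. [folklore] -/
theorem kernelT_zero {s : ℝ} (hs : s ≠ 1) :
    ((1 - s) - (0:ℝ) ^ 2 * (1 + s)) / ((1 - s) ^ 2 + (0:ℝ) ^ 2 * (1 + s) ^ 2) = 1 / (1 - s) := by
  have : (1 - s) ≠ 0 := sub_ne_zero.mpr (Ne.symm hs)
  field_simp
  ring

/-- `U(0,s) = 0`. [folklore] -/
theorem kernelU_zero (s : ℝ) :
    2 * (0:ℝ) / ((1 - s) ^ 2 + (0:ℝ) ^ 2 * (1 + s) ^ 2) = 0 := by simp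

/-! ## The four derivative facts (the certificates `∂_vT = −ω∂_s(sU)`, `∂_vU = ω∂_s(sT)`) -/

/-- **`∂_v T(v,s) = −4v(1−s²)/den²`** (`= −ω(v)·∂_s(sU)(v,s)`). [folklore] -/
theorem hasDerivAt_kernelT_param (v : ℝ) {s : ℝ} (hs : s ≠ 1) :
    HasDerivAt (fun v' : ℝ => ((1 - s) - v' ^ 2 * (1 + s)) / ((1 - s) ^ 2 + v' ^ 2 * (1 + s) ^ 2))
      (-(4 * v * (1 - s ^ 2)) / ((1 - s) ^ 2 + v ^ 2 * (1 + s) ^ 2) ^ 2) v := by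
  have hden := (den_pos v hs).ne'
  have hN : HasDerivAt (fun v' : ℝ => (1 - s) - v' ^ 2 * (1 + s))
      (-(((2 : ℕ) : ℝ) * v ^ (2 - 1) * (1 + s))) v :=
    HasDerivAt.const_sub (1 - s) (HasDerivAt.mul_const (hasDerivAt_pow 2 v) (1 + s))
  have hD : HasDerivAt (fun v' : ℝ => (1 - s) ^ 2 + v' ^ 2 * (1 + s) ^ 2)
      (((2 : ℕ) : ℝ) * v ^ (2 - 1) * (1 + s) ^ 2) v :=
    HasDerivAt.const_add ((1 - s) ^ 2) (HasDerivAt.mul_const (hasDerivAt_pow 2 v) ((1 + s) ^ 2))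
  refine (HasDerivAt.div hN hD hden).congr_deriv ?_
  norm_num
  field_simp
  ring

/-- **`∂_v U(v,s) = 2((1−s)² − v²(1+s)²)/den²`** (`= ω(v)·∂_s(sT)(v,s)`). [folklore] -/
theorem hasDerivAt_kernelU_param (v : ℝ) {s : ℝ} (hs : s ≠ 1) :
    HasDerivAt (fun v' : ℝ => 2 * v' / ((1 - s) ^ 2 + v' ^ 2 * (1 + s) ^ 2))
      (2 * ((1 - s) ^ 2 - v ^ 2 * (1 + s) ^ 2) / ((1 - s) ^ 2 + v ^ 2 * (1 + s) ^ 2) ^ 2) v := by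
  have hden := (den_pos v hs).ne'
  have hN : HasDerivAt (fun v' : ℝ => 2 * v') (2 * 1) v := HasDerivAt.const_mul 2 (hasDerivAt_id' v)
  have hD : HasDerivAt (fun v' : ℝ => (1 - s) ^ 2 + v' ^ 2 * (1 + s) ^ 2)
      (((2 : ℕ) : ℝ) * v ^ (2 - 1) * (1 + s) ^ 2) v :=
    HasDerivAt.const_add ((1 - s) ^ 2) (HasDerivAt.mul_const (hasDerivAt_pow 2 v) ((1 + s) ^ 2))
  refine (HasDerivAt.div hN hD hden).congr_deriv ?_
  norm_num
  field_simp
  ring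

/-- `∂_x ((1 − p x)² + v²(1 + p x)²) = −2p(1 − p x) + 2 v² p (1 + p x)`. [folklore] -/
theorem hasDerivAt_den_comp (v p x : ℝ) :
    HasDerivAt (fun x' : ℝ => (1 - p * x') ^ 2 + v ^ 2 * (1 + p * x') ^ 2)
      (-(2 * p * (1 - p * x)) + 2 * v ^ 2 * p * (1 + p * x)) x := by
  have h1 : HasDerivAt (fun x' : ℝ => 1 - p * x') (-(p * 1)) x :=
    HasDerivAt.const_sub 1 (HasDerivAt.const_mul p (hasDerivAt_id' x))
  have h2 : HasDerivAt (fun x' : ℝ => 1 + p * x') (p * 1) x :=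
    HasDerivAt.const_add 1 (HasDerivAt.const_mul p (hasDerivAt_id' x))
  have ha : HasDerivAt (fun x' : ℝ => (1 - p * x') * (1 - p * x'))
      (-(p * 1) * (1 - p * x) + (1 - p * x) * -(p * 1)) x := HasDerivAt.mul h1 h1
  have hb : HasDerivAt (fun x' : ℝ => v ^ 2 * ((1 + p * x') * (1 + p * x')))
      (v ^ 2 * (p * 1 * (1 + p * x) + (1 + p * x) * (p * 1))) x :=
    HasDerivAt.const_mul (v ^ 2) (HasDerivAt.mul h2 h2)
  have hab := HasDerivAt.add ha hb
  have hfun : (fun x' : ℝ => (1 - p * x') ^ 2 + v ^ 2 * (1 + p * x') ^ 2) =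
      fun x' => (1 - p * x') * (1 - p * x') + v ^ 2 * ((1 + p * x') * (1 + p * x')) := by
    funext x'; ring
  rw [hfun]
  refine hab.congr_deriv ?_
  ring

/-- **`∂_x (x·U(v, p x)) = ∂_s(sU)(v, p x) = 2v(1 − (px)²)(1+v²)/den(v,px)²`** — the primitive of the
second Newton–Leibniz move of the T-step. [folklore] -/
theorem hasDerivAt_mul_kernelU (v p x : ℝ) (hs : p * x ≠ 1) :
    HasDerivAt (fun x' : ℝ => x' * (2 * v / ((1 - p * x') ^ 2 + v ^ 2 * (1 + p * x') ^ 2)))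
      (2 * v * (1 - (p * x) ^ 2) * (1 + v ^ 2) / ((1 - p * x) ^ 2 + v ^ 2 * (1 + p * x) ^ 2) ^ 2) x := by
  have hden := (den_pos v hs).ne'
  have hq : HasDerivAt (fun x' : ℝ => 2 * v / ((1 - p * x') ^ 2 + v ^ 2 * (1 + p * x') ^ 2))
      ((0 * ((1 - p * x) ^ 2 + v ^ 2 * (1 + p * x) ^ 2) -
          2 * v * (-(2 * p * (1 - p * x)) + 2 * v ^ 2 * p * (1 + p * x))) /
        ((1 - p * x) ^ 2 + v ^ 2 * (1 + p * x) ^ 2) ^ 2) x :=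
    HasDerivAt.div (hasDerivAt_const x (2 * v)) (hasDerivAt_den_comp v p x) hden
  refine (HasDerivAt.mul (hasDerivAt_id' x) hq).congr_deriv ?_
  field_simp
  ring

/-- **`∂_x (x·T(v, p x)) = ∂_s(sT)(v, p x) = (1+v²)((1−px)² − v²(1+px)²)/den(v,px)²`** — the primitive
of the second Newton–Leibniz move of the U-step. [folklore] -/
theorem hasDerivAt_mul_kernelT (v p x : ℝ) (hs : p * x ≠ 1) :
    HasDerivAt (fun x' : ℝ => x' * (((1 - p * x') - v ^ 2 * (1 + p * x')) /
        ((1 - p * x') ^ 2 + v ^ 2 * (1 + p * x') ^ 2)))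
      ((1 + v ^ 2) * ((1 - p * x) ^ 2 - v ^ 2 * (1 + p * x) ^ 2) /
        ((1 - p * x) ^ 2 + v ^ 2 * (1 + p * x) ^ 2) ^ 2) x := by
  have hden := (den_pos v hs).ne'
  have h1 : HasDerivAt (fun x' : ℝ => 1 - p * x') (-(p * 1)) x :=
    HasDerivAt.const_sub 1 (HasDerivAt.const_mul p (hasDerivAt_id' x))
  have h2 : HasDerivAt (fun x' : ℝ => v ^ 2 * (1 + p * x')) (v ^ 2 * (p * 1)) x :=
    HasDerivAt.const_mul (v ^ 2) (HasDerivAt.const_add 1 (HasDerivAt.const_mul p (hasDerivAt_id' x)))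
  have hq : HasDerivAt (fun x' : ℝ => ((1 - p * x') - v ^ 2 * (1 + p * x')) /
        ((1 - p * x') ^ 2 + v ^ 2 * (1 + p * x') ^ 2))
      (((-(p * 1) - v ^ 2 * (p * 1)) * ((1 - p * x) ^ 2 + v ^ 2 * (1 + p * x) ^ 2) -
          ((1 - p * x) - v ^ 2 * (1 + p * x)) * (-(2 * p * (1 - p * x)) + 2 * v ^ 2 * p * (1 + p * x))) /
        ((1 - p * x) ^ 2 + v ^ 2 * (1 + p * x) ^ 2) ^ 2) x :=
    HasDerivAt.div (HasDerivAt.sub h1 h2) (hasDerivAt_den_comp v p x) hden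
  refine (HasDerivAt.mul (hasDerivAt_id' x) hq).congr_deriv ?_
  field_simp
  ring

/-! ## Continuity of the primitives along a fibre -/

/-- `v ↦ T(v,s)` is continuous (`s ≠ 1`). [folklore] -/
theorem continuous_kernelT_param {s : ℝ} (hs : s ≠ 1) :
    Continuous (fun v' : ℝ => ((1 - s) - v' ^ 2 * (1 + s)) / ((1 - s) ^ 2 + v' ^ 2 * (1 + s) ^ 2)) := by
  refine Continuous.div (by continuity) (by continuity) fun v' => (den_pos v' hs).ne'

/-- `v ↦ U(v,s)` is continuous (`s ≠ 1`). [folklore] -/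
theorem continuous_kernelU_param {s : ℝ} (hs : s ≠ 1) :
    Continuous (fun v' : ℝ => 2 * v' / ((1 - s) ^ 2 + v' ^ 2 * (1 + s) ^ 2)) := by
  refine Continuous.div (by continuity) (by continuity) fun v' => (den_pos v' hs).ne'

/-- `x ↦ x·U(v, p x)` is continuous on `[0,1]` when `p < 1` (then `p x ≠ 1`). [folklore] -/
theorem continuousOn_mul_kernelU (v : ℝ) {p : ℝ} (hp0 : 0 ≤ p) (hp : p < 1) :
    ContinuousOn (fun x' : ℝ => x' * (2 * v / ((1 - p * x') ^ 2 + v ^ 2 * (1 + p * x') ^ 2)))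
      (Set.Icc (0:ℝ) 1) := by
  refine ContinuousOn.mul continuousOn_id (ContinuousOn.div continuousOn_const (by fun_prop) ?_)
  intro x hx
  have hpx : p * x ≠ 1 := by
    have : p * x ≤ p * 1 := mul_le_mul_of_nonneg_left hx.2 hp0
    linarith
  exact (den_pos v hpx).ne'

/-- `x ↦ x·T(v, p x)` is continuous on `[0,1]` when `p < 1`. [folklore] -/
theorem continuousOn_mul_kernelT (v : ℝ) {p : ℝ} (hp0 : 0 ≤ p) (hp : p < 1) :
    ContinuousOn (fun x' : ℝ => x' * (((1 - p * x') - v ^ 2 * (1 + p * x')) /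
        ((1 - p * x') ^ 2 + v ^ 2 * (1 + p * x') ^ 2))) (Set.Icc (0:ℝ) 1) := by
  refine ContinuousOn.mul continuousOn_id (ContinuousOn.div (by fun_prop) (by fun_prop) ?_)
  intro x hx
  have hpx : p * x ≠ 1 := by
    have : p * x ≤ p * 1 := mul_le_mul_of_nonneg_left hx.2 hp0
    linarith
  exact (den_pos v hpx).ne'

/-! ## Two Young-type polynomial inequalities -/

/-- `A⁵B³ ≤ (A⁴+B⁴)²` for `A, B ≥ 0` (from `AB³ ≤ (A⁴+3B⁴)/4`, i.e. `(A−B)²(A²+2AB+3B²) ≥ 0`). [folklore] -/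
theorem pow_five_mul_pow_three_le (A B : ℝ) (hA : 0 ≤ A) (hB : 0 ≤ B) :
    A ^ 5 * B ^ 3 ≤ (A ^ 4 + B ^ 4) ^ 2 := by
  have hyoung : A * B ^ 3 ≤ A ^ 4 + B ^ 4 := by
    nlinarith [sq_nonneg (A - B), sq_nonneg (A + B), mul_nonneg hA hB, sq_nonneg (A ^ 2 - B ^ 2),
      mul_nonneg (mul_nonneg hA hB) (sq_nonneg (A - B)), pow_nonneg hB 4, pow_nonneg hA 4]
  have hA4 : 0 ≤ A ^ 4 := pow_nonneg hA 4
  have hB4 : 0 ≤ B ^ 4 := pow_nonneg hB 4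
  calc A ^ 5 * B ^ 3 = A ^ 4 * (A * B ^ 3) := by ring
    _ ≤ A ^ 4 * (A ^ 4 + B ^ 4) := mul_le_mul_of_nonneg_left hyoung hA4
    _ ≤ (A ^ 4 + B ^ 4) * (A ^ 4 + B ^ 4) := by
        apply mul_le_mul_of_nonneg_right _ (by positivity); linarith
    _ = (A ^ 4 + B ^ 4) ^ 2 := by ring

/-- `A³B ≤ A⁴+B⁴` for `A, B ≥ 0` (`(A−B)²(3A²+2AB+B²) ≥ 0`). [folklore] -/
theorem pow_three_mul_le (A B : ℝ) (hA : 0 ≤ A) (hB : 0 ≤ B) : A ^ 3 * B ≤ A ^ 4 + B ^ 4 := by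
  nlinarith [sq_nonneg (A - B), sq_nonneg (A + B), mul_nonneg hA hB, sq_nonneg (A ^ 2 - B ^ 2),
    mul_nonneg (mul_nonneg hA hB) (sq_nonneg (A - B)), pow_nonneg hB 4, pow_nonneg hA 4]

/-! ## The dominations `≤ C·a^{−3/2} b^{−1/2}` -/

/-- For `a, b > 0`: `a·b/(a²+b²)² ≤ a^{−3/2} b^{−1/2}`. [folklore] -/
theorem mul_div_sq_add_sq_sq_le {a b : ℝ} (ha : 0 < a) (hb : 0 < b) :
    a * b / (a ^ 2 + b ^ 2) ^ 2 ≤ a ^ (-(3/2 : ℝ)) * b ^ (-(1/2 : ℝ)) := by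
  set A := Real.sqrt a with hA
  set B := Real.sqrt b with hB
  have hA0 : 0 < A := Real.sqrt_pos.mpr ha
  have hB0 : 0 < B := Real.sqrt_pos.mpr hb
  have ha' : a = A ^ 2 := (Real.sq_sqrt ha.le).symm
  have hb' : b = B ^ 2 := (Real.sq_sqrt hb.le).symm
  have hpoly := pow_five_mul_pow_three_le A B hA0.le hB0.le
  -- rewrite the rpows through the square roots
  have hr1 : a ^ (-(3/2 : ℝ)) = (A ^ 3)⁻¹ := by
    rw [Real.rpow_neg ha.le, show (3/2 : ℝ) = 1 + 1/2 by norm_num, Real.rpow_add ha, Real.rpow_one,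
      ← Real.sqrt_eq_rpow, ← hA, ha']
    ring
  have hr2 : b ^ (-(1/2 : ℝ)) = B⁻¹ := by
    rw [Real.rpow_neg hb.le, ← Real.sqrt_eq_rpow, ← hB]
  rw [hr1, hr2, ha', hb']
  have hden : 0 < ((A ^ 2) ^ 2 + (B ^ 2) ^ 2) ^ 2 := by positivity
  rw [← mul_inv, ← one_div, div_le_div_iff₀ hden (by positivity), one_mul]
  calc A ^ 2 * B ^ 2 * (A ^ 3 * B) = A ^ 5 * B ^ 3 := by ring
    _ ≤ (A ^ 4 + B ^ 4) ^ 2 := hpoly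
    _ = ((A ^ 2) ^ 2 + (B ^ 2) ^ 2) ^ 2 := by ring

/-- For `a, b > 0`: `1/(a²+b²) ≤ a^{−3/2} b^{−1/2}`. [folklore] -/
theorem one_div_sq_add_sq_le {a b : ℝ} (ha : 0 < a) (hb : 0 < b) :
    1 / (a ^ 2 + b ^ 2) ≤ a ^ (-(3/2 : ℝ)) * b ^ (-(1/2 : ℝ)) := by
  set A := Real.sqrt a with hA
  set B := Real.sqrt b with hB
  have hA0 : 0 < A := Real.sqrt_pos.mpr ha
  have hB0 : 0 < B := Real.sqrt_pos.mpr hb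
  have ha' : a = A ^ 2 := (Real.sq_sqrt ha.le).symm
  have hb' : b = B ^ 2 := (Real.sq_sqrt hb.le).symm
  have hpoly := pow_three_mul_le A B hA0.le hB0.le
  have hr1 : a ^ (-(3/2 : ℝ)) = (A ^ 3)⁻¹ := by
    rw [Real.rpow_neg ha.le, show (3/2 : ℝ) = 1 + 1/2 by norm_num, Real.rpow_add ha, Real.rpow_one,
      ← Real.sqrt_eq_rpow, ← hA, ha']
    ring
  have hr2 : b ^ (-(1/2 : ℝ)) = B⁻¹ := by
    rw [Real.rpow_neg hb.le, ← Real.sqrt_eq_rpow, ← hB]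
  rw [hr1, hr2, ha', hb']
  rw [← mul_inv, ← one_div, div_le_div_iff₀ (by positivity) (by positivity), one_mul, one_mul]
  calc A ^ 3 * B ≤ A ^ 4 + B ^ 4 := hpoly
    _ = (A ^ 2) ^ 2 + (B ^ 2) ^ 2 := by ring

/-- For `a, b > 0`: `b/(a²+b²) ≤ a^{−1/2} b^{−1/2}` (the `m = 1` bound for the U-kernel). [folklore] -/
theorem div_sq_add_sq_le {a b : ℝ} (ha : 0 < a) (hb : 0 < b) :
    b / (a ^ 2 + b ^ 2) ≤ a ^ (-(1/2 : ℝ)) * b ^ (-(1/2 : ℝ)) := by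
  set A := Real.sqrt a with hA
  set B := Real.sqrt b with hB
  have hA0 : 0 < A := Real.sqrt_pos.mpr ha
  have hB0 : 0 < B := Real.sqrt_pos.mpr hb
  have ha' : a = A ^ 2 := (Real.sq_sqrt ha.le).symm
  have hb' : b = B ^ 2 := (Real.sq_sqrt hb.le).symm
  have hpoly := pow_three_mul_le B A hB0.le hA0.le
  have hr1 : a ^ (-(1/2 : ℝ)) = A⁻¹ := by
    rw [Real.rpow_neg ha.le, ← Real.sqrt_eq_rpow, ← hA]
  have hr2 : b ^ (-(1/2 : ℝ)) = B⁻¹ := by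
    rw [Real.rpow_neg hb.le, ← Real.sqrt_eq_rpow, ← hB]
  rw [hr1, hr2, ha', hb']
  rw [← mul_inv, ← one_div, div_le_div_iff₀ (by positivity) (by positivity), one_mul]
  calc B ^ 2 * (A * B) = B ^ 3 * A := by ring
    _ ≤ B ^ 4 + A ^ 4 := hpoly
    _ = (A ^ 2) ^ 2 + (B ^ 2) ^ 2 := by ring

/-! ## Pointwise bounds for the kernels and the band integrands (`0 ≤ s < 1`, `v > 0`) -/

/-- `|T(v,s)| ≤ 1/(1−s) + 1` for `0 ≤ s < 1`. [folklore] -/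
theorem abs_kernelT_le {v s : ℝ} (hs0 : 0 ≤ s) (hs1 : s < 1) :
    |((1 - s) - v ^ 2 * (1 + s)) / ((1 - s) ^ 2 + v ^ 2 * (1 + s) ^ 2)| ≤ 1 / (1 - s) + 1 := by
  have hs : s ≠ 1 := hs1.ne
  have hden := den_pos v hs
  have h1s : 0 < 1 - s := by linarith
  rw [abs_div, abs_of_pos hden, div_le_iff₀ hden]
  have hvs : 0 ≤ v ^ 2 * (1 + s) := mul_nonneg (sq_nonneg v) (by linarith)
  have hA : |(1 - s) - v ^ 2 * (1 + s)| ≤ (1 - s) + v ^ 2 * (1 + s) :=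
    abs_sub_le_iff.mpr ⟨by linarith, by linarith⟩
  have hB : (1 - s) + v ^ 2 * (1 + s) ≤ (1 / (1 - s) + 1) * ((1 - s) ^ 2 + v ^ 2 * (1 + s) ^ 2) := by
    rw [add_mul, div_mul_eq_mul_div, one_mul]
    have h1 : (1 - s) ≤ ((1 - s) ^ 2 + v ^ 2 * (1 + s) ^ 2) / (1 - s) := by
      rw [le_div_iff₀ h1s]
      nlinarith [sq_nonneg (v * (1 + s))]
    have h2 : v ^ 2 * (1 + s) ≤ 1 * ((1 - s) ^ 2 + v ^ 2 * (1 + s) ^ 2) := by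
      nlinarith [sq_nonneg (1 - s), sq_nonneg v, mul_nonneg (sq_nonneg v) hs0,
        mul_nonneg (mul_nonneg (sq_nonneg v) hs0) hs0]
    linarith
  exact hA.trans hB

/-- `0 ≤ U(v,s)` for `v ≥ 0`, `s ≠ 1`. [folklore] -/
theorem kernelU_nonneg {v s : ℝ} (hv : 0 ≤ v) (hs : s ≠ 1) :
    0 ≤ 2 * v / ((1 - s) ^ 2 + v ^ 2 * (1 + s) ^ 2) :=
  div_nonneg (mul_nonneg zero_le_two hv) (den_pos v hs).le

/-- `U(v,s) ≤ 1/(1−s)` for `0 ≤ s < 1` (any real `v`; AM–GM: `2v(1−s) ≤ (1−s)² + v²`). [folklore] -/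
theorem kernelU_le_one_div {v s : ℝ} (hs0 : 0 ≤ s) (hs1 : s < 1) :
    2 * v / ((1 - s) ^ 2 + v ^ 2 * (1 + s) ^ 2) ≤ 1 / (1 - s) := by
  have hs : s ≠ 1 := hs1.ne
  have hden := den_pos v hs
  have h1s : 0 < 1 - s := by linarith
  rw [div_le_div_iff₀ hden h1s, one_mul]
  nlinarith [sq_nonneg (1 - s - v), sq_add_sq_le_den (v := v) hs0]

/-- `U(v,s) ≤ 2(1−s)^{−1/2} v^{−1/2}` for `v > 0`, `0 ≤ s < 1` (the `m = 1` domination). [folklore] -/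
theorem kernelU_le_rpow {v s : ℝ} (hv : 0 < v) (hs0 : 0 ≤ s) (hs1 : s < 1) :
    2 * v / ((1 - s) ^ 2 + v ^ 2 * (1 + s) ^ 2) ≤ 2 * ((1 - s) ^ (-(1/2 : ℝ)) * v ^ (-(1/2 : ℝ))) := by
  have hs : s ≠ 1 := hs1.ne
  have hden := den_pos v hs
  have h1s : 0 < 1 - s := by linarith
  have hle : 2 * v / ((1 - s) ^ 2 + v ^ 2 * (1 + s) ^ 2) ≤ 2 * v / ((1 - s) ^ 2 + v ^ 2) :=
    div_le_div_of_nonneg_left (by positivity) (by positivity) (sq_add_sq_le_den hs0)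
  refine hle.trans ?_
  rw [mul_div_assoc]
  exact mul_le_mul_of_nonneg_left (div_sq_add_sq_le h1s hv) (by norm_num)

/-- `|∂_vT(v,s)| = 4v(1−s²)/den² ≤ 8(1−s)^{−3/2} v^{−1/2}` for `v > 0`, `0 ≤ s < 1` (the T-band domination).
[folklore] -/
theorem abs_deriv_kernelT_le_rpow {v s : ℝ} (hv : 0 < v) (hs0 : 0 ≤ s) (hs1 : s < 1) :
    |-(4 * v * (1 - s ^ 2)) / ((1 - s) ^ 2 + v ^ 2 * (1 + s) ^ 2) ^ 2| ≤
      8 * ((1 - s) ^ (-(3/2 : ℝ)) * v ^ (-(1/2 : ℝ))) := by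
  have hs : s ≠ 1 := hs1.ne
  have hden := den_pos v hs
  have h1s : 0 < 1 - s := by linarith
  have hnum : 0 ≤ 4 * v * (1 - s ^ 2) := by
    have : 0 ≤ 1 - s ^ 2 := by nlinarith
    positivity
  rw [neg_div, abs_neg, abs_of_nonneg (div_nonneg hnum (by positivity))]
  have h1 : 4 * v * (1 - s ^ 2) / ((1 - s) ^ 2 + v ^ 2 * (1 + s) ^ 2) ^ 2 ≤
      8 * ((1 - s) * v) / ((1 - s) ^ 2 + v ^ 2) ^ 2 := by
    have hle1 : 4 * v * (1 - s ^ 2) ≤ 8 * ((1 - s) * v) := by nlinarith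
    have hle2 : ((1 - s) ^ 2 + v ^ 2) ^ 2 ≤ ((1 - s) ^ 2 + v ^ 2 * (1 + s) ^ 2) ^ 2 :=
      pow_le_pow_left₀ (by positivity) (sq_add_sq_le_den hs0) 2
    calc 4 * v * (1 - s ^ 2) / ((1 - s) ^ 2 + v ^ 2 * (1 + s) ^ 2) ^ 2
        ≤ 8 * ((1 - s) * v) / ((1 - s) ^ 2 + v ^ 2 * (1 + s) ^ 2) ^ 2 :=
          div_le_div_of_nonneg_right hle1 (by positivity)
      _ ≤ 8 * ((1 - s) * v) / ((1 - s) ^ 2 + v ^ 2) ^ 2 :=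
          div_le_div_of_nonneg_left (by positivity) (by positivity) hle2
  refine h1.trans ?_
  rw [mul_div_assoc]
  exact mul_le_mul_of_nonneg_left (mul_div_sq_add_sq_sq_le h1s hv) (by norm_num)

/-- `|∂_vU(v,s)| = |2((1−s)² − v²(1+s)²)/den²| ≤ 2(1−s)^{−3/2} v^{−1/2}` for `v > 0`, `0 ≤ s < 1`
(the U-band domination). [folklore] -/
theorem abs_deriv_kernelU_le_rpow {v s : ℝ} (hv : 0 < v) (hs0 : 0 ≤ s) (hs1 : s < 1) :
    |2 * ((1 - s) ^ 2 - v ^ 2 * (1 + s) ^ 2) / ((1 - s) ^ 2 + v ^ 2 * (1 + s) ^ 2) ^ 2| ≤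
      2 * ((1 - s) ^ (-(3/2 : ℝ)) * v ^ (-(1/2 : ℝ))) := by
  have hs : s ≠ 1 := hs1.ne
  have hden := den_pos v hs
  have h1s : 0 < 1 - s := by linarith
  have habs : |(1 - s) ^ 2 - v ^ 2 * (1 + s) ^ 2| ≤ (1 - s) ^ 2 + v ^ 2 * (1 + s) ^ 2 :=
    abs_sub_le_iff.mpr ⟨by nlinarith [sq_nonneg ((1 + s) * v)], by nlinarith [sq_nonneg (1 - s)]⟩
  rw [abs_div, abs_mul, abs_of_pos (by norm_num : (0:ℝ) < 2), abs_of_pos (pow_pos hden 2)]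
  have h1 : 2 * |(1 - s) ^ 2 - v ^ 2 * (1 + s) ^ 2| / ((1 - s) ^ 2 + v ^ 2 * (1 + s) ^ 2) ^ 2 ≤
      2 * (1 / ((1 - s) ^ 2 + v ^ 2)) := by
    rw [mul_one_div, div_le_div_iff₀ (by positivity) (by positivity)]
    calc 2 * |(1 - s) ^ 2 - v ^ 2 * (1 + s) ^ 2| * ((1 - s) ^ 2 + v ^ 2)
        ≤ 2 * ((1 - s) ^ 2 + v ^ 2 * (1 + s) ^ 2) * ((1 - s) ^ 2 + v ^ 2 * (1 + s) ^ 2) := by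
          apply mul_le_mul (mul_le_mul_of_nonneg_left habs (by norm_num)) (sq_add_sq_le_den hs0)
            (by positivity) (by positivity)
      _ = 2 * ((1 - s) ^ 2 + v ^ 2 * (1 + s) ^ 2) ^ 2 := by ring
  refine h1.trans ?_
  exact mul_le_mul_of_nonneg_left (one_div_sq_add_sq_le h1s hv) (by norm_num)

end Summit.KontsevichZagierPeriods.Theorems.HurwitzMicroSectorsHurwitzSectorComplement.LadderEngine

namespace Summit.KontsevichZagierPeriods.Theorems.HurwitzMicroSectorsHurwitzSectorComplement

/-- **Registered sub-goal of `stub_ladderEngine` (band dominations).** For `v > 0`, `0 ≤ s < 1`: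
`|∂_vT(v,s)| ≤ 8(1−s)^{−3/2}v^{−1/2}` and `|∂_vU(v,s)| ≤ 2(1−s)^{−3/2}v^{−1/2}` — the pointwise bounds
that make the two Newton–Leibniz bands of the ladder absolutely integrable. [folklore] -/
theorem ladderEngine_kernelBounds :
    (∀ (v s : ℝ), 0 < v → 0 ≤ s → s < 1 →
      |-(4 * v * (1 - s ^ 2)) / ((1 - s) ^ 2 + v ^ 2 * (1 + s) ^ 2) ^ 2| ≤
        8 * ((1 - s) ^ (-(3/2 : ℝ)) * v ^ (-(1/2 : ℝ)))) ∧
    (∀ (v s : ℝ), 0 < v → 0 ≤ s → s < 1 →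
      |2 * ((1 - s) ^ 2 - v ^ 2 * (1 + s) ^ 2) / ((1 - s) ^ 2 + v ^ 2 * (1 + s) ^ 2) ^ 2| ≤
        2 * ((1 - s) ^ (-(3/2 : ℝ)) * v ^ (-(1/2 : ℝ)))) :=
  ⟨fun _ _ hv hs0 hs1 => LadderEngine.abs_deriv_kernelT_le_rpow hv hs0 hs1,
    fun _ _ hv hs0 hs1 => LadderEngine.abs_deriv_kernelU_le_rpow hv hs0 hs1⟩

end Summit.KontsevichZagierPeriods.Theorems.HurwitzMicroSectorsHurwitzSectorComplement

end
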